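import Mathlib.Data.Real.Basic
import Mathlib.Algebra.Order.Field.Basic
import Mathlib.Algebra.BigOperators.Ring.Finset
import Mathlib.Algebra.Order.BigOperators.Group.Finset
import Mathlib.Tactic.Linarith
import Mathlib.Tactic.Positivity
import Mathlib.Tactic.Ring
import Mathlib.Tactic.FieldSimp
import Mathlib.Tactic.LinearCombination
import HarnessLib

/-!
# `NoHeavyLowerTail` (stmt-CriticalPhenomena-4575) — the POTENTIAL METHOD on decision trees for the layer-cake inequality (LC-F),
# the deferral (pairing) and merging identities of the fixed-order telescoping, and the one-step potential algebra

Support file (prover prim-ineq-gen-8 gen 47; `--supports stmt-CriticalPhenomena-4575`; memo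
run/shared/lean/prim/prim-ineq-gen-8/FINDING-gen47-POTENTIAL.md).  Pure real algebra: no definitions, no named facts, no sorries.

SETTING (memo FINDING-gen46b-LAYERCAKE.md §2, FINDING-gen47 §1).  A decision tree explores the percolation configuration edge by edge;
the node (= state) `s` is reached with probability `w_s`, queries an edge of weight `p_s`, and carries the reward
`r_s = p_s (1 − p_s) a_s² · 1[m̂_s ≤ m]` (small-piece variance) or any other per-state quantity.  The layer-cake inequality (LC-F) for the
tree `T` reads `Σ_s w_s r_s ≤ m · Σ_z ℓ_z p_z (1 − p_z)`.  The POTENTIAL METHOD (FINDING-gen47 §4): if a function `Φ` of the state satisfies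
`Φ(s) ≥ r_s + p_s Φ(s¹) + (1 − p_s) Φ(s⁰)` at every node (`s¹, s⁰` the two children) and `Φ ≥ 0` at the leaves, then
`Σ_s w_s r_s ≤ Φ(root)`; dually a SUB-solution bounds the total from below (used for the big-piece variance `X_big`).

THIS FILE proves [this work]:
* (companion file `…APLVwDecisionTree.lean`: `DTree.total_le_pot` / `DTree.pot_le_total` — the potential method and its dual on finite
  weighted binary trees, by induction; this file is the definition-free algebra.)
* `potential_step_big`, `potential_step_small` — the one-step algebra of the candidate potential `Φ = min(m F, Ψ)` (memo §4):
  with the martingale splits `F = p q c + p F¹ + q F⁰`, and `Ψ ≥ p q a² 1[small] + p Ψ¹ + q Ψ⁰` (any superharmonic `Ψ ≤ V`),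
  a BIG root costs nothing, and a SMALL root closes as soon as `p q (a² − m c) ≤ p (m F¹ − Ψ¹)⁺ + q (m F⁰ − Ψ⁰)⁺` — the local
  inequality (L) whose status is the subject of memo §4 (true for `Ψ = V − X_big`, false for every finite-lookahead truncation).
* `deferral_identity`, `merge_identity` — the two exact bookkeeping identities behind the fixed-order telescoping of memo §2:
  `p Σ ℓ φ₁² + q Σ ℓ φ₀² = Σ ℓ (q φ₀ + p φ₁)² + p q Σ ℓ (φ₁ − φ₀)²` (and the same for `a`), and the two-group merging formula
  `α (m c₁ − a₁²) + β (m c₂ − a₂²) = (α+β)(m c̄ − ā²) + (αβ/(α+β)) (m c^Δ − δ²)` for `ā = (α a₁ + β a₂)/(α+β)` etc.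
-/

noncomputable section

namespace Summit.CriticalPhenomena.PercolationContinuityZ3.Theorems

namespace APL

open Finset
open scoped BigOperators

/-! ### One-step algebra of the candidate potential `Φ = min (m F) Ψ` -/

/-- **Big root is free.**  If `F = p q c + p F¹ + q F⁰` with `c ≥ 0` and `Ψ ≥ p Ψ¹ + q Ψ⁰` (no reward at a big root), then
`p · min(m F¹, Ψ¹) + q · min(m F⁰, Ψ⁰) ≤ min(m F, Ψ)` for `m ≥ 0`, `p ∈ [0,1]`. [this work] -/
theorem potential_step_big (m p c F F1 F0 Ψ Ψ1 Ψ0 : ℝ) (hm : 0 ≤ m) (hp0 : 0 ≤ p) (hp1 : p ≤ 1) (hc : 0 ≤ c)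
    (hF : F = p * (1 - p) * c + p * F1 + (1 - p) * F0) (hΨ : p * Ψ1 + (1 - p) * Ψ0 ≤ Ψ) :
    p * min (m * F1) Ψ1 + (1 - p) * min (m * F0) Ψ0 ≤ min (m * F) Ψ := by
  have hq : 0 ≤ 1 - p := by linarith
  have a1 : p * min (m * F1) Ψ1 ≤ p * (m * F1) := mul_le_mul_of_nonneg_left (min_le_left _ _) hp0
  have a2 : (1 - p) * min (m * F0) Ψ0 ≤ (1 - p) * (m * F0) := mul_le_mul_of_nonneg_left (min_le_left _ _) hq
  have b1 : p * min (m * F1) Ψ1 ≤ p * Ψ1 := mul_le_mul_of_nonneg_left (min_le_right _ _) hp0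
  have b2 : (1 - p) * min (m * F0) Ψ0 ≤ (1 - p) * Ψ0 := mul_le_mul_of_nonneg_left (min_le_right _ _) hq
  have hpq : 0 ≤ m * (p * (1 - p) * c) := by positivity
  refine le_min ?_ ?_
  · calc p * min (m * F1) Ψ1 + (1 - p) * min (m * F0) Ψ0 ≤ p * (m * F1) + (1 - p) * (m * F0) := by linarith
      _ ≤ m * F := by rw [hF]; nlinarith
  · linarith

/-- **Small root: reduction to the local inequality (L).**  If `F = p q c + p F¹ + q F⁰`, `Ψ ≥ p q a² + p Ψ¹ + q Ψ⁰` (the reward of a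
small root is `p q a²`) and the local inequality `p q (a² − m c) ≤ p (m F¹ − Ψ¹)⁺ + q (m F⁰ − Ψ⁰)⁺` holds, then the potential
`min(m F, Ψ)` absorbs the step: `p q a² + p min(m F¹, Ψ¹) + q min(m F⁰, Ψ⁰) ≤ min(m F, Ψ)`. [this work] -/
theorem potential_step_small (m p a c F F1 F0 Ψ Ψ1 Ψ0 : ℝ) (hp0 : 0 ≤ p) (hp1 : p ≤ 1)
    (hF : F = p * (1 - p) * c + p * F1 + (1 - p) * F0) (hΨ : p * (1 - p) * a ^ 2 + p * Ψ1 + (1 - p) * Ψ0 ≤ Ψ)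
    (hL : p * (1 - p) * (a ^ 2 - m * c) ≤ p * max (m * F1 - Ψ1) 0 + (1 - p) * max (m * F0 - Ψ0) 0) :
    p * (1 - p) * a ^ 2 + p * min (m * F1) Ψ1 + (1 - p) * min (m * F0) Ψ0 ≤ min (m * F) Ψ := by
  have hq : 0 ≤ 1 - p := by linarith
  -- `min (m Fⁱ) Ψⁱ = m Fⁱ − (m Fⁱ − Ψⁱ)⁺`
  have e1 : min (m * F1) Ψ1 = m * F1 - max (m * F1 - Ψ1) 0 := by
    rcases le_total (m * F1) Ψ1 with h | h
    · rw [min_eq_left h, max_eq_right (by linarith)]; ring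
    · rw [min_eq_right h, max_eq_left (by linarith)]; ring
  have e0 : min (m * F0) Ψ0 = m * F0 - max (m * F0 - Ψ0) 0 := by
    rcases le_total (m * F0) Ψ0 with h | h
    · rw [min_eq_left h, max_eq_right (by linarith)]; ring
    · rw [min_eq_right h, max_eq_left (by linarith)]; ring
  have b1 : p * min (m * F1) Ψ1 ≤ p * Ψ1 := mul_le_mul_of_nonneg_left (min_le_right _ _) hp0
  have b2 : (1 - p) * min (m * F0) Ψ0 ≤ (1 - p) * Ψ0 := mul_le_mul_of_nonneg_left (min_le_right _ _) hq
  refine le_min ?_ ?_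
  · rw [e1, e0, hF]
    nlinarith
  · linarith

/-- The local inequality (L) is implied by its unsigned form: if `V − m F ≤ p B¹ + q B⁰` where `V = p q a² + p V¹ + q V⁰`,
`F = p q c + p F¹ + q F⁰`, and `Ψⁱ = Vⁱ − Bⁱ`, then `p q (a² − m c) ≤ p (m F¹ − Ψ¹)⁺ + q (m F⁰ − Ψ⁰)⁺`
("the excess variance of the state is paid by certified big variance of the children"). [this work] -/
theorem local_ineq_of_excess (m p a c F F1 F0 V V1 V0 B1 B0 : ℝ) (hp0 : 0 ≤ p) (hp1 : p ≤ 1)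
    (hF : F = p * (1 - p) * c + p * F1 + (1 - p) * F0) (hV : V = p * (1 - p) * a ^ 2 + p * V1 + (1 - p) * V0)
    (hex : V - m * F ≤ p * B1 + (1 - p) * B0) :
    p * (1 - p) * (a ^ 2 - m * c) ≤ p * max (m * F1 - (V1 - B1)) 0 + (1 - p) * max (m * F0 - (V0 - B0)) 0 := by
  have hq : 0 ≤ 1 - p := by linarith
  have c1 : p * (m * F1 - (V1 - B1)) ≤ p * max (m * F1 - (V1 - B1)) 0 :=
    mul_le_mul_of_nonneg_left (le_max_left _ _) hp0
  have c0 : (1 - p) * (m * F0 - (V0 - B0)) ≤ (1 - p) * max (m * F0 - (V0 - B0)) 0 :=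
    mul_le_mul_of_nonneg_left (le_max_left _ _) hq
  have key : p * (1 - p) * (a ^ 2 - m * c) ≤ p * (m * F1 - (V1 - B1)) + (1 - p) * (m * F0 - (V0 - B0)) := by
    rw [hF, hV] at hex; nlinarith
  linarith

/-! ### The deferral (pairing) identity and the merging identity of the fixed-order telescoping -/

/-- **Deferral identity (vector part).**  Averaging the two branch values `φ₀, φ₁` of an increment with weights `q = 1 − p`, `p` loses exactly
`p q Σ ℓ (φ₁ − φ₀)²` of the `ℓ`-weighted square mass:  `p Σ ℓ φ₁² + q Σ ℓ φ₀² = Σ ℓ (q φ₀ + p φ₁)² + p q Σ ℓ (φ₁ − φ₀)²`. [this work] -/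
theorem deferral_identity {ι : Type*} (s : Finset ι) (ℓ φ₀ φ₁ : ι → ℝ) (p : ℝ) :
    p * ∑ z ∈ s, ℓ z * φ₁ z ^ 2 + (1 - p) * ∑ z ∈ s, ℓ z * φ₀ z ^ 2
      = ∑ z ∈ s, ℓ z * ((1 - p) * φ₀ z + p * φ₁ z) ^ 2 + p * (1 - p) * ∑ z ∈ s, ℓ z * (φ₁ z - φ₀ z) ^ 2 := by
  rw [Finset.mul_sum, Finset.mul_sum, Finset.mul_sum, ← Finset.sum_add_distrib, ← Finset.sum_add_distrib]
  refine Finset.sum_congr rfl fun z _ => ?_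
  ring

/-- **Deferral identity (scalar part).**  `p a₁² + q a₀² = (q a₀ + p a₁)² + p q (a₁ − a₀)²`. [this work] -/
theorem deferral_identity_scalar (p a₀ a₁ : ℝ) :
    p * a₁ ^ 2 + (1 - p) * a₀ ^ 2 = ((1 - p) * a₀ + p * a₁) ^ 2 + p * (1 - p) * (a₁ - a₀) ^ 2 := by
  ring

/-- **One-step pairing of the layer-cake functional** (memo §2, the step identity behind `σ = Σ_k Σ_g π_g ROOT_g`): for smallness
indicators `s₀, s₁ ∈ {0,1}` (as reals with `sᵢ (1 − sᵢ) = 0` not even needed), the plain two-branch contribution equals the deferred term plus the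
cross term plus the per-branch big bonus:
`p (m c₁ − s₁ a₁²) + q (m c₀ − s₀ a₀²) = [m c_def − a_def²] + p q [m c^Δ − δ²] + p (1 − s₁) a₁² + q (1 − s₀) a₀²`
whenever `p c₁ + q c₀ = c_def + p q c^Δ` and `a_def = q a₀ + p a₁`, `δ = a₁ − a₀` (the vector identity above supplies the first). [this work] -/
theorem pairing_step (m p c₀ c₁ cdef cΔ a₀ a₁ s₀ s₁ : ℝ) (hc : p * c₁ + (1 - p) * c₀ = cdef + p * (1 - p) * cΔ) :
    p * (m * c₁ - s₁ * a₁ ^ 2) + (1 - p) * (m * c₀ - s₀ * a₀ ^ 2)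
      = (m * cdef - ((1 - p) * a₀ + p * a₁) ^ 2) + p * (1 - p) * (m * cΔ - (a₁ - a₀) ^ 2)
        + p * (1 - s₁) * a₁ ^ 2 + (1 - p) * (1 - s₀) * a₀ ^ 2 := by
  have : m * (p * c₁ + (1 - p) * c₀) = m * (cdef + p * (1 - p) * cΔ) := by rw [hc]
  linear_combination this

/-- **Merging identity.**  Merging two world-groups of weights `α, β > 0` with data `(a₁,c₁)`, `(a₂,c₂)` into one group with the averaged
data `ā = (α a₁ + β a₂)/(α+β)`, `c̄` defined through `(α+β) c̄ = α c₁ + β c₂ − (αβ/(α+β)) c^Δ` (for the vector data this is the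
between-group square mass, `c^Δ = Σ ℓ (φ₁ − φ₂)²`), changes the functional by the between-group term:
`α (m c₁ − a₁²) + β (m c₂ − a₂²) = (α+β)(m c̄ − ā²) + (αβ/(α+β)) (m c^Δ − (a₁ − a₂)²)`. [this work] -/
theorem merge_identity (m α β a₁ a₂ c₁ c₂ cbar cΔ : ℝ) (hα : 0 < α) (hβ : 0 < β)
    (hc : (α + β) * cbar = α * c₁ + β * c₂ - α * β / (α + β) * cΔ) :
    α * (m * c₁ - a₁ ^ 2) + β * (m * c₂ - a₂ ^ 2)
      = (α + β) * (m * cbar - ((α * a₁ + β * a₂) / (α + β)) ^ 2) + α * β / (α + β) * (m * cΔ - (a₁ - a₂) ^ 2) := by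
  have hs : α + β ≠ 0 := by positivity
  have e1 : (α + β) * (m * cbar) = m * (α * c₁ + β * c₂) - m * (α * β / (α + β) * cΔ) := by
    linear_combination m * hc
  have e2 : (α + β) * ((α * a₁ + β * a₂) / (α + β)) ^ 2 = (α * a₁ + β * a₂) ^ 2 / (α + β) := by
    field_simp
  have e3 : α * a₁ ^ 2 + β * a₂ ^ 2 = (α * a₁ + β * a₂) ^ 2 / (α + β) + α * β / (α + β) * (a₁ - a₂) ^ 2 := by
    field_simp; ring
  calc α * (m * c₁ - a₁ ^ 2) + β * (m * c₂ - a₂ ^ 2)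
      = m * (α * c₁ + β * c₂) - (α * a₁ ^ 2 + β * a₂ ^ 2) := by ring
    _ = m * (α * c₁ + β * c₂) - ((α * a₁ + β * a₂) ^ 2 / (α + β) + α * β / (α + β) * (a₁ - a₂) ^ 2) := by rw [e3]
    _ = (α + β) * (m * cbar - ((α * a₁ + β * a₂) / (α + β)) ^ 2)
          + α * β / (α + β) * (m * cΔ - (a₁ - a₂) ^ 2) := by
        rw [mul_sub (α + β), e1, e2]; ring

/-- The between-group square mass is the variance decomposition: `α Σ ℓ φ₁² + β Σ ℓ φ₂² = (α+β) Σ ℓ φ̄² + (αβ/(α+β)) Σ ℓ (φ₁ − φ₂)²`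
with `φ̄ = (α φ₁ + β φ₂)/(α+β)` — i.e. the hypothesis `hc` of `merge_identity` holds with `c̄ = Σ ℓ φ̄²`, `c^Δ = Σ ℓ (φ₁ − φ₂)²`. [this work] -/
theorem merge_vector {ι : Type*} (s : Finset ι) (ℓ φ₁ φ₂ : ι → ℝ) (α β : ℝ) (hα : 0 < α) (hβ : 0 < β) :
    (α + β) * ∑ z ∈ s, ℓ z * ((α * φ₁ z + β * φ₂ z) / (α + β)) ^ 2
      = α * ∑ z ∈ s, ℓ z * φ₁ z ^ 2 + β * ∑ z ∈ s, ℓ z * φ₂ z ^ 2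
        - α * β / (α + β) * ∑ z ∈ s, ℓ z * (φ₁ z - φ₂ z) ^ 2 := by
  have hs : α + β ≠ 0 := by positivity
  rw [Finset.mul_sum, Finset.mul_sum, Finset.mul_sum, Finset.mul_sum, ← Finset.sum_add_distrib, ← Finset.sum_sub_distrib]
  refine Finset.sum_congr rfl fun z _ => ?_
  field_simp
  ring

end APL

end Summit.CriticalPhenomena.PercolationContinuityZ3.Theorems

end
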